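import Literature.AnabelianGeometry.AbsoluteAnabelian.MLFGaloisPairsWitness
import Mathlib.Topology.ContinuousOn
import HarnessLib

/-!
# [AbsTopIII] Def 3.1 (i)/(ii) — NON-VACUITY of the `TS⊞`-pair interface `GaloisLCAPair` (row «NV-L4/GaloisLCAPair»)

Mochizuki, *Topics in Absolute Anabelian Geometry III*, Def 3.1 (i)(ii) pp. 66–67 (kurims manuscript, lit key
`paper:url-5493eb38cbb7`); typed by abc-iut-L4-t2 in `MLFGaloisPairs.lean`: `GaloisLCAPair` = "an abstract pair
`(Π ↷ M)` for `T = TS⊞`: `M` an (ind-)locally compact ABELIAN TOPOLOGICAL GROUP and `Π` acting continuously by group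
automorphisms", with the predicate `IsMLFGaloisLCAPair` ("for some model data `(k, k̄, Π_k ↠ G_k)`, `Π ≅ Π_k` and the
action is pulled back along `ε_k` from a FAITHFUL continuous action of `G_k`"). PROOF-ONLY companion (no `def`, no
`instance`, no `structure`). abc-iut-w5-d197's INHABITATION CENSUS L4 v1 (§A) lists `GaloisLCAPair` with ZERO producers.

THE WITNESS (GENUINE Galois data, discrete topology on `M`): for EVERY model datum `D = (Π_k ↠ G_k)` over every
MLF-closure `C = (k, k̄)` (abc-iut-L4-t2's `MLFClosure` / `ModelMLFGaloisData`; concrete instances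
`MLFClosure.ofPadic p`, `ModelMLFGaloisData.galProd`), the pair `(Π_k ↷ k̄ˣ)` — `Π_k` acting through `ε_k` by the
Galois action (L4-t2's `unitsAction`), `k̄ˣ` carrying the DISCRETE topology — is a `TS⊞`-pair AND an MLF-Galois
one:
* `exists_galoisLCAPair_of_model` — `∃ P : GaloisLCAPair, P.Pi = D.Pi ∧ P.M = (C.K)ˣ ∧ IsMLFGaloisLCAPair P`;
  continuity = Krull-open stabilisers (`ModelMLFGaloisData.isOpen_stabilizer_comp`, ultimately Mathlib's
  `IntermediateField.fixingSubgroup_isOpen`) + `continuous_prod_of_discrete_right`; local compactness and the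
  topological-group axioms of `k̄ˣ` are those of a discrete group (proved inline); FAITHFULNESS of `G_k ↷ k̄ˣ` from
  L4-t2's `MLFClosure.algEquiv_eq_one_of_forall_nonzeroIntegers` (an automorphism fixing every non-zero integer —
  a fortiori every unit of the field `k̄` — is `1`);
* `exists_isMLFGaloisLCAPair` — on CLOSED TERMS: over `k = ℚ_p`, `k̄ = AlgebraicClosure ℚ_p`, `Π_k := G_k × ℤ`
  (`MLFClosure.ofPadic p`, `galProd`), for every prime `p`.

HONEST LABEL: GENUINE as to the Galois data (the actual `G_{ℚ_p}`, the actual `ℚ̄_pˣ`, the actual Galois action,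
faithfulness a theorem); the TOPOLOGY on `M = k̄ˣ` is the DISCRETE one — a locally compact abelian group, as the
typed `TS⊞` asks, but NOT the printed ind-topology of `k̄ˣ` (colimit of the locally compact `Kˣ`, `K/k` finite),
which the tree does not model; with the discrete topology "continuous action" = "open stabilisers" = the usual
discrete `G_k`-module structure. Nothing of [AbsTopIII] is asserted; a witness is consistency evidence only.
[cite: MochizukiAbsTopIII2015, Definition 3.1 (i) p.66]
-/

noncomputable section

namespace Literature.AnabelianGeometry.AbsoluteAnabelian

open _root_.Topology

/-- **AbsTopIII:Def3.1(i)** (kurims p.66) For EVERY model datum `D = (Π_k ↠ G_k)` over an MLF-closure `C = (k, k̄)`: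
the pair `(Π_k ↷ k̄ˣ)` (Galois action through `ε_k`, DISCRETE topology on `k̄ˣ`) is a `TS⊞`-pair (`GaloisLCAPair`:
locally compact abelian topological group, continuous action by automorphisms) which IS an MLF-Galois `TS⊞`-pair
(`IsMLFGaloisLCAPair`: `Π ≅ Π_k` by the identity, action pulled back along `ε_k` from the FAITHFUL continuous action of
`G_k`). GENUINE Galois data; discrete (not ind-) topology on `M` — see the module docstring.
[cite: MochizukiAbsTopIII2015, Definition 3.1 (ii) p.67] -/
theorem exists_galoisLCAPair_of_model (C : MLFClosure.{0}) (D : ModelMLFGaloisData C.k C.K) :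
    ∃ P : GaloisLCAPair.{0}, P.Pi = D.Pi ∧ P.M = (C.K)ˣ ∧ IsMLFGaloisLCAPair P := by
  -- the discrete topology on `k̄ˣ` and its consequences
  letI tM : TopologicalSpace (C.K)ˣ := ⊥
  haveI hdisc : DiscreteTopology (C.K)ˣ := ⟨rfl⟩
  haveI htg : IsTopologicalGroup (C.K)ˣ :=
    { continuous_mul := continuous_of_discreteTopology
      continuous_inv := continuous_of_discreteTopology }
  haveI hlc : LocallyCompactSpace (C.K)ˣ :=
    ⟨fun x n hn => ⟨{x}, by rw [nhds_discrete]; exact Filter.mem_pure.2 rfl,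
      Set.singleton_subset_iff.2 (mem_of_mem_nhds hn), isCompact_singleton⟩⟩
  -- the `G_k`-action on `k̄ˣ` (restriction of the field action to units), as a bare function
  let act : (C.K ≃ₐ[C.k] C.K) → (C.K)ˣ → (C.K)ˣ := fun σ u =>
    Units.map (MulDistribMulAction.toMonoidHom C.K σ) u
  have act_coe : ∀ σ u, ((act σ u : (C.K)ˣ) : C.K) = σ (u : C.K) := fun _ _ => rfl
  -- Krull-open stabilisers in `G_k` (L4-t2's lemma at the model datum `Π_k := G_k`, `ε_k := id`)
  let D₀ : ModelMLFGaloisData C.k C.K :=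
    { Pi := C.K ≃ₐ[C.k] C.K, aug := MonoidHom.id _, continuous_aug := continuous_id,
      aug_surjective := Function.surjective_id }
  have hstab : ∀ x : C.K, IsOpen (MulAction.stabilizer (C.K ≃ₐ[C.k] C.K) x : Set (C.K ≃ₐ[C.k] C.K)) :=
    fun x => D₀.isOpen_stabilizer_comp x
  -- continuity of `σ ↦ act σ u` into the DISCRETE `k̄ˣ`: every fibre is a left coset of an open stabiliser
  have hcontG : Continuous fun p : (C.K ≃ₐ[C.k] C.K) × (C.K)ˣ => act p.1 p.2 := by
    refine continuous_prod_of_discrete_right.2 fun u => ?_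
    refine continuous_def.2 fun s _ => isOpen_iff_mem_nhds.2 fun σ hσ => ?_
    have hsub : (fun τ => σ * τ) '' (MulAction.stabilizer (C.K ≃ₐ[C.k] C.K) (u : C.K) : Set _) ⊆
        (fun τ : C.K ≃ₐ[C.k] C.K => act τ u) ⁻¹' s := by
      rintro _ ⟨τ, hτ, rfl⟩
      have hτu : τ (u : C.K) = u := hτ
      have heq : act (σ * τ) u = act σ u := Units.ext (by rw [act_coe, act_coe, AlgEquiv.mul_apply, hτu])
      show act (σ * τ) u ∈ s
      rw [heq]; exact hσ
    exact Filter.mem_of_superset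
      (((Homeomorph.mulLeft σ).isOpenMap _ (hstab (u : C.K))).mem_nhds ⟨1, Subgroup.one_mem _, mul_one σ⟩) hsub
  -- continuity of the `Π_k`-action = pull back along the continuous `ε_k`
  have hsmul : ∀ (g : D.Pi) (u : (C.K)ˣ), g • u = act (D.aug g) u := fun _ _ => rfl
  have hcont : Continuous fun p : D.Pi × (C.K)ˣ => p.1 • p.2 := by
    have : (fun p : D.Pi × (C.K)ˣ => p.1 • p.2) =
        (fun p : (C.K ≃ₐ[C.k] C.K) × (C.K)ˣ => act p.1 p.2) ∘ fun p => (D.aug p.1, p.2) := by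
      funext p; exact hsmul p.1 p.2
    rw [this]
    exact hcontG.comp ((D.continuous_aug.comp continuous_fst).prodMk continuous_snd)
  -- faithfulness of `G_k ↷ k̄ˣ`
  have hfaith : ∀ σ : C.K ≃ₐ[C.k] C.K, (∀ u : (C.K)ˣ, act σ u = u) → σ = 1 := by
    intro σ hσ
    refine MLFClosure.algEquiv_eq_one_of_forall_nonzeroIntegers C σ fun x hx => ?_
    have h := congrArg (fun v : (C.K)ˣ => (v : C.K)) (hσ (Units.mk0 x hx.2))
    simpa [act_coe] using h
  -- assemble
  let P : GaloisLCAPair.{0} :=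
    { Pi := D.Pi, M := (C.K)ˣ, instTopM := tM, instTopGrpM := htg, instLC := hlc,
      instAction := D.unitsAction, continuous_smul := hcont }
  refine ⟨P, rfl, rfl, ⟨C, D, ContinuousMulEquiv.refl _, act, hcontG, fun g m => hsmul g m, hfaith⟩⟩

/-- **AbsTopIII:Def3.1(ii)** (kurims p.67) On CLOSED TERMS: MLF-Galois `TS⊞`-pairs exist — over `k = ℚ_p`,
`k̄ = AlgebraicClosure ℚ_p`, `Π_k := G_k × ℤ` (abc-iut-L4-t2's `MLFClosure.ofPadic`, `ModelMLFGaloisData.galProd`),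
`M := ℚ̄_pˣ` discrete, for every prime `p`. [cite: MochizukiAbsTopIII2015, Definition 3.1 (ii) p.67] -/
theorem exists_isMLFGaloisLCAPair (p : ℕ) [Fact p.Prime] : ∃ P : GaloisLCAPair.{0}, IsMLFGaloisLCAPair P := by
  obtain ⟨P, -, -, hP⟩ := exists_galoisLCAPair_of_model (MLFClosure.ofPadic p)
    (ModelMLFGaloisData.galProd (MLFClosure.ofPadic p) (Multiplicative ℤ))
  exact ⟨P, hP⟩

/-- **AbsTopIII:Def3.1(i)** (kurims p.66) In particular the interface `GaloisLCAPair` is inhabited (closed term,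
`p = 2`). [cite: MochizukiAbsTopIII2015, Definition 3.1 (i) p.66] -/
theorem GaloisLCAPair.nonempty_model : Nonempty GaloisLCAPair.{0} :=
  let ⟨P, _⟩ := exists_isMLFGaloisLCAPair 2; ⟨P⟩

end Literature.AnabelianGeometry.AbsoluteAnabelian

end
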